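import Summits.HodgeConjecture.HodgeConjecture.Theorems.Ring2AbelianAllAndreJunction
import Summits.HodgeConjecture.HodgeConjecture.Theorems.Ring2AbelianAllAndreGraded
import Literature.AlgebraicGeometry.HodgeTheory.LefschetzStandardOfHodgeConjectureSquare
import Literature.AlgebraicGeometry.HodgeTheory.LefschetzOneOneHolds
import HarnessLib

/-!
# Ring 2 · sub-cell AbelianAll (ALL ABELIAN VARIETIES), André axis — ab-andre-1 part VII: the GRADED Lefschetz
# nodes `(5∀)_d`, `(5)_d` and the graded row `HC_CM ∧ (5)_{2g} ⟹ HC` for abelian `g`-folds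

HONEST FRAMING (page 1, verbatim): **research route, not a corollary; conditional on HC_CM plus one named
minimal statement.** Cell line: research route conditional on HC_CM; not a corollary; Q11.4-sentence-2
already refuted in dim ≥ 3. Nothing in this file proves an open case of the Hodge conjecture. `HC_CM` =
`Theses.RankFourFaces.CMAbelianHodge` (a BINDER, never cited as a fact), `HC_AV` =
`Theses.PadicSemiregularLift.HodgeAbelianVarieties`; the item `Theses.RankFourFaces.CMToAbelian`
(stmt-HodgeConjecture-16267) is OPEN and not closed here. Seat `pub-hodge-ring2-ab-andre-1`, gen 4; companion of
part VI (`Ring2AbelianAllLefschetzPencilsOnPath`) and of andre-2's graded transport node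
(`Ring2AbelianAllAndreGraded.CMAnchoredTransportAtRelDim`).

## Content

* §C GRADED LEFSCHETZ NODES `LefschetzBCompactPencilsAtRelDim d` = `(5∀)_d` and
  `LefschetzBCMPointedPencilsAtRelDim d` = `(5)_d` (conjecture `B` for the `(d+1)`-dimensional total spaces of
  compact pencils of abelian `d`-folds, resp. of those with a CM fibre): the blanket nodes (5∀) =
  `LefschetzBCompactPencils` = `CompactAbelianPencilLefschetz` and (5) = `LefschetzBCMPointedPencils` ⟺
  `CMPointedPencilLefschetz` are their conjunctions over `d` (definitionally); `(5∀)_d ⟹ (5)_d ⟹[h₈]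
  CMAnchoredTransportAtRelDim d`; hence the GRADED ROW `HC_CM ∧ (5)_{2g} ⟹ HCAtDim g` modulo `h₈` (Abdulali
  pp. 1122–1123) and `h₂₁` (Lemme 6.3.1) — for the abelian FOURFOLDS the Lefschetz input is `B` for the
  NINE-dimensional total spaces of CM-pointed compact pencils of abelian EIGHTFOLDS
  (`hcAtDim_four_of_HC_CM_of_abdulali_of_lefschetzBCMPointedPencilsAtRelDim_eight`); graded on-path with its exact
  cost (`HodgeConjectureFor (2d+2) (𝒳 × 𝒳)`), fact-free.
* §D the unconditional foot `(5∀)_0` (total space a CURVE: `B` from Lefschetz (1,1) on the square surface through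
  the Kleiman theorem of the tree) — DEGENERATE, no Hodge-theoretic content, recorded only as the first rung;
  `(5∀)_1` (elliptic surfaces: `B` for surfaces) is a theorem in print (Kleiman 1968 / Lieberman) NOT in the tree,
  and `(5∀)_d`, `d ≥ 2`, is open except Tankeev's cases (threefolds of Kodaira dimension `< 3`; abelian schemes
  with restricted generic Hodge group), none typed.

NOT CLAIMED: `HC_AV ⟹ (5)_d`; monotonicity of `(5)_d` / `(5∀)_d` in `d`; minimality of any node; any discharge of `h₈`.

References: Andre1996Motifs (§6.3, Lemme 6.3.1, Remarque 2 p. 33); Abdulali1994FamiliesAV (pp. 1122–1123, Lemma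
6.2); Milne2020HodgeClassesAV (Thm. 4, Prop. 1); Voisin2025 (§3.2.2 (15)–(16), Lemma 2.9); Grothendieck1968 (§3);
Kleiman1968AlgebraicCycles (§2); VoisinHodgeII2003 (§10.2.3); Tankeev2011 (main theorem). No `sorry`, no new
axiom; two `@[conjecture]` definitions (graded obligation nodes, nothing asserted); every theorem is a short
instantiation.
-/

noncomputable section

-- The summit's namespace repeats `HodgeConjecture` (summit = sub-problem); every file of the axis disables this linter.
set_option linter.dupNamespace false

namespace Summit.HodgeConjecture.HodgeConjecture.Ring2.AbelianAll

open CategoryTheory AlgebraicGeometry MonoidalCategory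
open Literature.AlgebraicGeometry Literature.AlgebraicGeometry.Motives
open Literature.AlgebraicGeometry.HodgeTheory
open Literature.AlgebraicGeometry.Abdulali1994 (InvariantCyclesHoldFor
  Abdulali1994_invariantCycles_of_lefschetzStandard)
open Literature.AlgebraicGeometry.Andre1996 (andre1996_cmAnchoredPencil)
open Literature.AlgebraicGeometry.Deligne1982 (cmLocus)
open Summit.HodgeConjecture.HodgeConjecture
open Summit.HodgeConjecture.HodgeConjecture.Theses
open Summit.HodgeConjecture.HodgeConjecture.Ring2.ClassTargets (HCAtDim HCUpToDim)

/-! ## §C The graded Lefschetz nodes `(5∀)_d`, `(5)_d` -/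

/-- **`(5∀)_d` — conjecture `B` for the total spaces of compact pencils of abelian `d`-folds**: for every compact
pencil of abelian varieties `f : 𝒳 ⟶ S` of relative dimension `d` and every `η ∈ H²(𝒳(ℂ); ℂ)`,
`StandardConjectureBStar (d + 1) 𝒳 η` (the `(d+1)`-dimensional total space). The blanket node (5∀) =
`LefschetzBCompactPencils` = `CompactAbelianPencilLefschetz` is the conjunction over `d`
(`lefschetzBCompactPencils_iff_forall_atRelDim`). A THEOREM for `d = 0` (§D, degenerate); in print for `d = 1`
(surfaces; not in the tree); OPEN for `d ≥ 2` except Tankeev's cases. A HYPOTHESIS wherever used.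
[cite: Andre1996Motifs, §6.3 Remarque 2 (p. 33)] [cite: Grothendieck1968, §3 p. 196 (B(X))] [cite: Tankeev2011, main theorem (κ < 3)] -/
@[conjecture] def LefschetzBCompactPencilsAtRelDim (d : ℕ) : Prop :=
  ∀ ⦃𝒳 S : SchemeOver ℂ⦄ (f : 𝒳 ⟶ S), IsCompactAbelianPencil f d →
    ∀ η : complexBetti 𝒳 2, StandardConjectureBStar (d + 1) 𝒳 η

/-- **`(5)_d` — the same for the compact pencils of abelian `d`-folds HAVING A CM FIBRE** (`cmLocus f d` non-empty;
the pencils of Lemme 6.3.1 through a `g`-fold are such, with `d = 2g`). The blanket node (5) =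
`LefschetzBCMPointedPencils` is the conjunction over `d`. OPEN for `d ≥ 2`; a HYPOTHESIS wherever used.
[cite: Andre1996Motifs, Lemme 6.3.1 (ii) (p. 31) and Remarque 2 (p. 33)] -/
@[conjecture] def LefschetzBCMPointedPencilsAtRelDim (d : ℕ) : Prop :=
  ∀ ⦃𝒳 S : SchemeOver ℂ⦄ (f : 𝒳 ⟶ S), IsCompactAbelianPencil f d → (cmLocus f d).Nonempty →
    ∀ η : complexBetti 𝒳 2, StandardConjectureBStar (d + 1) 𝒳 η

/-- (5∀) is the conjunction of the `(5∀)_d` (definitionally). [folklore] -/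
theorem lefschetzBCompactPencils_iff_forall_atRelDim :
    LefschetzBCompactPencils ↔ ∀ d : ℕ, LefschetzBCompactPencilsAtRelDim d :=
  Iff.rfl

/-- … and so is andre-1's spelling `CompactAbelianPencilLefschetz`. [folklore] -/
theorem compactAbelianPencilLefschetz_iff_forall_atRelDim :
    CompactAbelianPencilLefschetz ↔ ∀ d : ℕ, LefschetzBCompactPencilsAtRelDim d :=
  Iff.rfl

/-- (5) is the conjunction of the `(5)_d` (definitionally). [folklore] -/
theorem lefschetzBCMPointedPencils_iff_forall_atRelDim :
    LefschetzBCMPointedPencils ↔ ∀ d : ℕ, LefschetzBCMPointedPencilsAtRelDim d :=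
  Iff.rfl

/-- … and andre-1's spelling `CMPointedPencilLefschetz` too (through the junction's
`lefschetzBCMPointedPencils_iff_cmPointedPencilLefschetz`). [folklore] -/
theorem cmPointedPencilLefschetz_iff_forall_atRelDim :
    CMPointedPencilLefschetz ↔ ∀ d : ℕ, LefschetzBCMPointedPencilsAtRelDim d :=
  lefschetzBCMPointedPencils_iff_cmPointedPencilLefschetz.symm.trans lefschetzBCMPointedPencils_iff_forall_atRelDim

/-- `(5∀)_d ⟹ (5)_d`. [folklore] -/
theorem lefschetzBCMPointedPencilsAtRelDim_of_lefschetzBCompactPencilsAtRelDim {d : ℕ}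
    (h : LefschetzBCompactPencilsAtRelDim d) : LefschetzBCMPointedPencilsAtRelDim d :=
  fun _ _ f hf _ ↦ h f hf

/-- **`(5)_d ⟹ (1.1) on every CM-pointed compact pencil of relative dimension `d`**, granted Abdulali pp. 1122–1123 (`h₈`).
[cite: Abdulali1994FamiliesAV, pp. 1122–1123] [cite: Milne2020HodgeClassesAV, Prop. 1 (p. 7)] -/
theorem invariantCyclesHoldFor_of_abdulali_of_lefschetzBCMPointedPencilsAtRelDim
    (h₈ : Abdulali1994_invariantCycles_of_lefschetzStandard) {d : ℕ} (hB : LefschetzBCMPointedPencilsAtRelDim d)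
    {𝒳 S : SchemeOver ℂ} {f : 𝒳 ⟶ S} (hf : IsCompactAbelianPencil f d) (hCM : (cmLocus f d).Nonempty) :
    InvariantCyclesHoldFor f d :=
  h₈ f hf (hB f hf hCM)

/-- **`(5)_d ⟹ CMAnchoredTransportAtRelDim d`** (andre-2's graded `B_min`), granted `h₈`: the graded form of part I §C.
[cite: Abdulali1994FamiliesAV, pp. 1122–1123 and Lemma 6.2 (p. 1131)] [cite: Andre1996Motifs, §6.3 a) (p. 33)] -/
theorem cmAnchoredTransportAtRelDim_of_abdulali_of_lefschetzBCMPointedPencilsAtRelDim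
    (h₈ : Abdulali1994_invariantCycles_of_lefschetzStandard) {d : ℕ} (hB : LefschetzBCMPointedPencilsAtRelDim d) :
    CMAnchoredTransportAtRelDim d :=
  fun _ _ _ hf p W hW t ht h₀ s ↦
    invariantCyclesHoldFor_of_abdulali_of_lefschetzBCMPointedPencilsAtRelDim h₈ hB hf ⟨t, ht⟩ p W hW ⟨t, h₀⟩ s

/-- `(5∀)_d ⟹ CMAnchoredTransportAtRelDim d`, granted `h₈`. [cite: Abdulali1994FamiliesAV, pp. 1122–1123] -/
theorem cmAnchoredTransportAtRelDim_of_abdulali_of_lefschetzBCompactPencilsAtRelDim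
    (h₈ : Abdulali1994_invariantCycles_of_lefschetzStandard) {d : ℕ} (hB : LefschetzBCompactPencilsAtRelDim d) :
    CMAnchoredTransportAtRelDim d :=
  cmAnchoredTransportAtRelDim_of_abdulali_of_lefschetzBCMPointedPencilsAtRelDim h₈
    (lefschetzBCMPointedPencilsAtRelDim_of_lefschetzBCompactPencilsAtRelDim hB)

/-- **GRADED ROW: `HC_CM ∧ (5)_{2g} ⟹ HCAtDim g`**, granted `h₈` (Abdulali) and `h₂₁` (Lemme 6.3.1): the Hodge conjecture
for abelian `g`-folds from `HC_CM` and conjecture `B` for the `(2g+1)`-dimensional total spaces of CM-pointed compact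
pencils of abelian `2g`-folds (the pencil of Lemme 6.3.1 through `A` has fibres isogenous to `A × A`). Composition of
`(5)_{2g} ⟹[h₈] CMAnchoredTransportAtRelDim (2g)` with andre-2's `hcAtDim_of_HC_CM_of_cmAnchoredTransportAtRelDim`.
research route, not a corollary; conditional on HC_CM plus one named minimal statement.
[cite: Andre1996Motifs, Lemme 6.3.1 (p. 31), §6.3 a) and Remarque 2 (p. 33)] [cite: Abdulali1994FamiliesAV, pp. 1122–1123] -/
theorem hcAtDim_of_HC_CM_of_abdulali_of_lefschetzBCMPointedPencilsAtRelDim_double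
    (h₈ : Abdulali1994_invariantCycles_of_lefschetzStandard) (h₂₁ : andre1996_cmAnchoredPencil)
    (hCM : RankFourFaces.CMAbelianHodge) (g : ℕ) (hB : LefschetzBCMPointedPencilsAtRelDim (2 * g)) : HCAtDim g :=
  hcAtDim_of_HC_CM_of_cmAnchoredTransportAtRelDim h₂₁ hCM g
    (cmAnchoredTransportAtRelDim_of_abdulali_of_lefschetzBCMPointedPencilsAtRelDim h₈ hB)

/-- The same row from the CM-free graded node: `HC_CM ∧ (5∀)_{2g} ⟹ HCAtDim g`, granted `h₈`, `h₂₁`.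
[cite: Andre1996Motifs, §6.3 Remarque 2 (p. 33)] -/
theorem hcAtDim_of_HC_CM_of_abdulali_of_lefschetzBCompactPencilsAtRelDim_double
    (h₈ : Abdulali1994_invariantCycles_of_lefschetzStandard) (h₂₁ : andre1996_cmAnchoredPencil)
    (hCM : RankFourFaces.CMAbelianHodge) (g : ℕ) (hB : LefschetzBCompactPencilsAtRelDim (2 * g)) : HCAtDim g :=
  hcAtDim_of_HC_CM_of_abdulali_of_lefschetzBCMPointedPencilsAtRelDim_double h₈ h₂₁ hCM g
    (lefschetzBCMPointedPencilsAtRelDim_of_lefschetzBCompactPencilsAtRelDim hB)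

/-- **All dimensions up to `g`**: `HC_CM ∧ (∀ g' ≤ g, (5)_{2g'}) ⟹ HCUpToDim g`, granted `h₈`, `h₂₁` (the graded node is not
known to be monotone in `d`, so the input is assumed at every even relative dimension `≤ 2g`).
[cite: Andre1996Motifs, §6.3 a) (p. 33)] -/
theorem hcUpToDim_of_HC_CM_of_abdulali_of_lefschetzBCMPointedPencilsAtRelDim
    (h₈ : Abdulali1994_invariantCycles_of_lefschetzStandard) (h₂₁ : andre1996_cmAnchoredPencil)
    (hCM : RankFourFaces.CMAbelianHodge) (g : ℕ) (hB : ∀ g' ≤ g, LefschetzBCMPointedPencilsAtRelDim (2 * g')) :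
    HCUpToDim g :=
  hcUpToDim_of_HC_CM_of_cmAnchoredTransportAtRelDim h₂₁ hCM g fun g' hg' ↦
    cmAnchoredTransportAtRelDim_of_abdulali_of_lefschetzBCMPointedPencilsAtRelDim h₈ (hB g' hg')

/-- **The `g = 4` row**: `HC_CM ∧ (5)_8 ⟹ HCAtDim 4`, granted `h₈`, `h₂₁` — on the Lefschetz flavour of the André axis the
abelian FOURFOLDS (the first dimension with open `HC`; Weil classes) cost conjecture `B` for the NINE-dimensional
total spaces of CM-pointed compact pencils of abelian EIGHTFOLDS. [cite: Andre1996Motifs, Lemme 6.3.1 (p. 31) and Remarque 2 (p. 33)] -/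
theorem hcAtDim_four_of_HC_CM_of_abdulali_of_lefschetzBCMPointedPencilsAtRelDim_eight
    (h₈ : Abdulali1994_invariantCycles_of_lefschetzStandard) (h₂₁ : andre1996_cmAnchoredPencil)
    (hCM : RankFourFaces.CMAbelianHodge) (hB : LefschetzBCMPointedPencilsAtRelDim 8) : HCAtDim 4 :=
  hcAtDim_of_HC_CM_of_abdulali_of_lefschetzBCMPointedPencilsAtRelDim_double h₈ h₂₁ hCM 4 hB

/-- **Graded on-path with its exact cost**: `(5∀)_d` follows from the Hodge conjecture for the `(2d+2)`-folds `𝒳 × 𝒳`,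
`𝒳` ranging over the total spaces of compact pencils of abelian `d`-folds (fact-free). [cite: Voisin2025, §3.2.2 (15)–(16)] -/
theorem lefschetzBCompactPencilsAtRelDim_of_hodgeConjectureFor_sq {d : ℕ}
    (h : ∀ ⦃𝒳 S : SchemeOver ℂ⦄ (f : 𝒳 ⟶ S), IsCompactAbelianPencil f d →
      HodgeConjectureFor ((d + 1) + (d + 1)) (𝒳 ⊗ 𝒳)) :
    LefschetzBCompactPencilsAtRelDim d :=
  fun _ _ f hf η ↦ standardConjectureBStar_of_hodgeConjectureFor_prod hf.isSmoothProjective_total (h f hf) η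

/-- **Graded on-path, fact-free**: `HodgeConjecture ⟹ (5∀)_d` for every `d`. [cite: Voisin2025, §3.2.2] -/
theorem lefschetzBCompactPencilsAtRelDim_of_hodgeConjecture (h : _root_.HodgeConjecture) (d : ℕ) :
    LefschetzBCompactPencilsAtRelDim d :=
  lefschetzBCompactPencils_iff_forall_atRelDim.1
    (lefschetzBCompactPencils_of_hodgeConjecture Kleiman1968_lefschetzInvolution_algebraic_of_hodgeClasses_prod_holds h) d

/-- **Graded on-path, fact-free**: `HodgeConjecture ⟹ (5)_d` for every `d`. [cite: Voisin2025, §3.2.2] -/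
theorem lefschetzBCMPointedPencilsAtRelDim_of_hodgeConjecture (h : _root_.HodgeConjecture) (d : ℕ) :
    LefschetzBCMPointedPencilsAtRelDim d :=
  lefschetzBCMPointedPencilsAtRelDim_of_lefschetzBCompactPencilsAtRelDim
    (lefschetzBCompactPencilsAtRelDim_of_hodgeConjecture h d)

/-! ## §D The degenerate foot `d = 0` (unconditional) -/

/-- **`(5∀)_0` holds (DEGENERATE foot, no Hodge-theoretic content)**: the total space of a compact pencil of relative
dimension `0` is a smooth projective CURVE `𝒳`, its square a surface, on which the Hodge conjecture is Lefschetz (1,1)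
(`hodgeConjectureFor_of_dim_le_three_holds`); the Kleiman theorem of the tree then gives `B*(𝒳)`. Recorded only as the
first rung of the graded ladder `(5∀)_d`; the first rung with content, `d = 1` (`B` for elliptic surfaces), is a
theorem in print not in the tree. [cite: VoisinHodgeII2003, §10.2.3] [cite: Kleiman1968AlgebraicCycles, §2] -/
theorem lefschetzBCompactPencilsAtRelDim_zero : LefschetzBCompactPencilsAtRelDim 0 :=
  lefschetzBCompactPencilsAtRelDim_of_hodgeConjectureFor_sq fun _ _ _ hf ↦
    hodgeConjectureFor_of_dim_le_three_holds (by norm_num)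
      (IsSmoothProjective.tensor_holds hf.isSmoothProjective_total hf.isSmoothProjective_total)

/-- `(5)_0` holds (degenerate foot). [cite: VoisinHodgeII2003, §10.2.3] -/
theorem lefschetzBCMPointedPencilsAtRelDim_zero : LefschetzBCMPointedPencilsAtRelDim 0 :=
  lefschetzBCMPointedPencilsAtRelDim_of_lefschetzBCompactPencilsAtRelDim lefschetzBCompactPencilsAtRelDim_zero

end Summit.HodgeConjecture.HodgeConjecture.Ring2.AbelianAll

end
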